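import Literature.AnabelianGeometry.AbsoluteAnabelian.AbsTopII.InertiaGroupsScope

/-!
# [AbsTopII] Prop 1.3 (x) as typed: the FREE point-kind label — kernel certificates

S. Mochizuki, *Topics in Absolute Anabelian Geometry II* [AbsTopII] (bib `MochizukiAbsTopII2013`;
locators = PDF pages of the kurims manuscript `paper:url-585b8d0ad0d9`), §1, Prop 1.3 (x) p. 12:

> "(x) Let `τ_I : I → Π_I` be the [outer] homomorphism that arises [by functoriality!] from a 'log
> point' `τ_S ∈ X^{log}(S^{log})`. […] Then if `τ_I` is non-verticial and non-edge-like, then the image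
> of `τ_S` is the unique cusp `e_τ` of `X` such that […] `τ_I(I) ⊆ D_{e_τ}`.  Now suppose that the image
> of `τ_S` is not a cusp.  Then `τ_I` satisfies the condition `τ_I(I) = I_{v_τ}` for some vertex `v_τ`
> […] if and only if the image of `τ_S` is a non-nodal point of the irreducible component of `X`
> corresponding to `v_τ`; `τ_I` is non-verticial and satisfies the condition `τ_I(I) ⊆ I_{e_τ}` for
> some node `e_τ` […] if and only if the image of `τ_S` is the node of `X` corresponding to `e_τ`."

FINDING F-L4t6g6-1 (abc-iut-L4-t6, typer of record, against ITS OWN typing): in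
`AbsTopII/InertiaGroups.lean` (p405221) a log point is recorded by the structure `LogPointData` =
(a closed section image `τ_I(I) ⊆ Π_I` of `Π_I ↠ I`) + (a label `kind : PointKind` = "the image of
`τ_S` in `X`"), and `Prop_1_3_x` / its `Π_𝔾`-scope successor `Prop_1_3_x'`
(`AbsTopII/InertiaGroupsScope.lean`, p427207) quantify `∀ τ : X.LogPointData` — i.e. over EVERY
labelled section, the label being FREE.  Print relates the GEOMETRIC image point of `τ_S` (a datum
determined by `τ_S`) to the position of `τ_I(I)`; the typed predicates instead demand that EVERY label
attached to every section be the consistent one.  Consequently they are FALSE at any DPSC datum with a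
section image `I_v` (every genuine datum: `I_v ↪ I` is an isomorphism, Prop 1.3 (iii)) and either a
second vertex `w ≠ v` (relabel the section "smooth point of `w`") or a node `e` (relabel it "the node
`e`") — the kernel certificates below.  REPAIR (statements file `AbsTopII/InertiaGroupsLogPoints.lean`,
`DPSCIndexData.Prop_1_3_x''`): quantify over a FAMILY of log points `pt : L → X.LogPointData` supplied
by the model (the log points of `X^{log}(S^{log})` with their true images and kinds), not over the type
of all labelled sections.

PROOF-ONLY (no definition):
* `not_prop_1_3_x'_of_two_vertices`, `not_prop_1_3_x_of_two_vertices` — `I_v` a closed complement of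
  `Π_𝔾` in `Π_I` and a vertex `w ≠ v` refute the typed (x′), resp. (x);
* `not_prop_1_3_x'_of_node`, `not_prop_1_3_x_of_node` — idem with a node instead of a second vertex;
* `not_prop_1_3_x'_of_prop13iii`, `not_prop_1_3_x_of_prop13iii` — the section hypotheses supplied by
  abc-iut-L4-t4's typed Prop 1.3 (iii) (`DPSCData.Prop13iii`: `I_v ∩ Π_𝔾 = {1}`, `I_v · Π_𝔾 = Π_I`), so
  the typed (iii) ∧ (x′) are jointly unsatisfiable at any datum with `I_v` closed and two vertices.
HONEST FRAMING: a statement-faithfulness finding about the cell's own typing, with its repair; it says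
nothing about the truth of the printed Prop 1.3 (x) and nothing about [IUTchIII] Cor 3.12.
-/

open scoped Pointwise

namespace Literature.AnabelianGeometry.AbsoluteAnabelian.AbsTopII.DPSCIndexData

universe u

variable (X : DPSCIndexData.{u})

/-- **Certificate (x′), two vertices.** If `I_v` is a closed complement of `Π_𝔾` in `Π_I` (a section of
`Π_I ↠ I`, as at every datum of Def 1.2 (ii) by Prop 1.3 (iii)) and `w ≠ v` is another vertex, then the
typed `Prop_1_3_x'` FAILS: the labelled section (`I_v`, "smooth point of `w`") violates the first
biconditional of the non-cuspidal clause at `v`. [cite: MochizukiAbsTopII2013, Prop 1.3 (x) p.12] -/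
theorem not_prop_1_3_x'_of_two_vertices {v w : X.Vert} (hvw : v ≠ w)
    (hcl : IsClosed (X.Iv v : Set X.PiH)) (hinf : X.Iv v ⊓ X.PiG = ⊥) (hsup : X.Iv v ⊔ X.PiG = X.PiI) :
    ¬ X.Prop_1_3_x' := by
  intro h
  -- the labelled section (`I_v`, "smooth point of `w`"), a legitimate inhabitant of `X.LogPointData`
  let τ : X.LogPointData := ⟨X.Iv v, inf_le_right, hcl, hinf, hsup, PointKind.smooth w⟩
  have h2 := (h τ).2 (fun e hk => by simp [τ] at hk)
  have hv : τ.kind = PointKind.smooth v := (h2.1 v).mp ⟨1, X.PiG.one_mem, by simp [τ]⟩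
  have : PointKind.smooth (N := X.Node) (C := X.Cusp) w = PointKind.smooth v := hv
  exact hvw (PointKind.smooth.inj this).symm

/-- **Certificate (x), two vertices** (the v1 predicate of `InertiaGroups.lean`, `Π_H`-scope): same
labelled section, same failure. [cite: MochizukiAbsTopII2013, Prop 1.3 (x) p.12] -/
theorem not_prop_1_3_x_of_two_vertices {v w : X.Vert} (hvw : v ≠ w)
    (hcl : IsClosed (X.Iv v : Set X.PiH)) (hinf : X.Iv v ⊓ X.PiG = ⊥) (hsup : X.Iv v ⊔ X.PiG = X.PiI) :
    ¬ X.Prop_1_3_x := by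
  intro h
  let τ : X.LogPointData := ⟨X.Iv v, inf_le_right, hcl, hinf, hsup, PointKind.smooth w⟩
  have h2 := (h τ).2 (fun e hk => by simp [τ] at hk)
  have hv : τ.kind = PointKind.smooth v := (h2.1 v).mp ⟨1, by simp [τ]⟩
  have : PointKind.smooth (N := X.Node) (C := X.Cusp) w = PointKind.smooth v := hv
  exact hvw (PointKind.smooth.inj this).symm

/-- **Certificate (x′), one node.** If `I_v` is a closed complement of `Π_𝔾` in `Π_I` and `e` is a node,
then the typed `Prop_1_3_x'` FAILS: the labelled section (`I_v`, "the node `e`") violates the second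
biconditional of the non-cuspidal clause (`I_v` is verticial). [cite: MochizukiAbsTopII2013, Prop 1.3 (x) p.12] -/
theorem not_prop_1_3_x'_of_node (v : X.Vert) (e : X.Node)
    (hcl : IsClosed (X.Iv v : Set X.PiH)) (hinf : X.Iv v ⊓ X.PiG = ⊥) (hsup : X.Iv v ⊔ X.PiG = X.PiI) :
    ¬ X.Prop_1_3_x' := by
  intro h
  -- the labelled section (`I_v`, "the node `e`"); it is verticial
  let τ : X.LogPointData := ⟨X.Iv v, inf_le_right, hcl, hinf, hsup, PointKind.node e⟩
  have h2 := (h τ).2 (fun e' hk => by simp [τ] at hk)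
  have hne : τ.IsNonVerticial := ((h2.2 e).mpr rfl).1
  exact hne v 1 (by simp [τ])

/-- **Certificate (x), one node** (v1 predicate). [cite: MochizukiAbsTopII2013, Prop 1.3 (x) p.12] -/
theorem not_prop_1_3_x_of_node (v : X.Vert) (e : X.Node)
    (hcl : IsClosed (X.Iv v : Set X.PiH)) (hinf : X.Iv v ⊓ X.PiG = ⊥) (hsup : X.Iv v ⊔ X.PiG = X.PiI) :
    ¬ X.Prop_1_3_x := by
  intro h
  -- the labelled section (`I_v`, "the node `e`"); it is verticial
  let τ : X.LogPointData := ⟨X.Iv v, inf_le_right, hcl, hinf, hsup, PointKind.node e⟩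
  have h2 := (h τ).2 (fun e' hk => by simp [τ] at hk)
  have hne : τ.IsNonVerticial := ((h2.2 e).mpr rfl).1
  exact hne v 1 (by simp [τ])

/-- **Certificate (iii) + (x′).** With the section hypotheses supplied by abc-iut-L4-t4's typed
Prop 1.3 (iii) (`DPSCData.Prop13iii`: "`I_v ≅ I`", i.e. `I_v ∩ Π_𝔾 = {1}` and `I_v · Π_𝔾 = Π_I`), the
typed (iii) and (x′) are JOINTLY UNSATISFIABLE at any DPSC datum with two vertices and `I_v` closed.
[cite: MochizukiAbsTopII2013, Prop 1.3 (iii)(x) pp.11–12] -/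
theorem not_prop_1_3_x'_of_prop13iii (hiii : X.toDPSCData.Prop13iii) {v w : X.Vert} (hvw : v ≠ w)
    (hcl : IsClosed (X.Iv v : Set X.PiH)) : ¬ X.Prop_1_3_x' :=
  X.not_prop_1_3_x'_of_two_vertices hvw hcl (hiii v).1 (hiii v).2

/-- **Certificate (iii) + (x)** (v1 predicate). [cite: MochizukiAbsTopII2013, Prop 1.3 (iii)(x) pp.11–12] -/
theorem not_prop_1_3_x_of_prop13iii (hiii : X.toDPSCData.Prop13iii) {v w : X.Vert} (hvw : v ≠ w)
    (hcl : IsClosed (X.Iv v : Set X.PiH)) : ¬ X.Prop_1_3_x :=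
  X.not_prop_1_3_x_of_two_vertices hvw hcl (hiii v).1 (hiii v).2

end Literature.AnabelianGeometry.AbsoluteAnabelian.AbsTopII.DPSCIndexData
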